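import Summits.Langlands.Langlands.Theses.CapacityClassicality
import Summits.Langlands.Langlands.Theorems.CapacityClassicalityCongruenceToClassicalDefs
import Summits.Langlands.Langlands.Theorems.CapacityClassicalityCongruenceToClassicalCuspBound
import Summits.Langlands.Langlands.Theorems.CapacityClassicalityCongruenceToClassicalHeckeIdentity
import Summits.Langlands.Langlands.Theorems.CapacityClassicalityCongruenceToClassicalQuotient

/-!
# Route CapacityClassicality — the glue `CongruenceToClassical` (item stmt-Langlands-10367)

`IntegralOverconvergentIsCongruence → EigenIntegralOverconvergentIsClassical` (α → β′):
given the data of β′ (an `O_E`-integral, archimedean-radius-one, Katz-overconvergent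
`q`-expansion `g = ∑ σ₀(a n) qⁿ` of weight `k` with `a 1 = 1` that is `T_ℓ`-eigen in
`q`-expansion form for every prime `ℓ ∤ N p`), α provides a level `M`, an `m : ℕ` and a classical
form `F ∈ M_{k+12m}(Γ₁(M))` with `qExpansion 1 F = g · Δ ^ m`. Then `G := F / Δ ^ m` is
holomorphic on `ℍ`, `Γ₁(M)`-invariant of weight `k`, equals `∑ σ₀(a n) qⁿ` on `ℍ` (Cauchy
product), hence satisfies the `T_ℓ` functional equation for one prime `ℓ > N p` (file
`…HeckeIdentity`), and each translate `(G ∣ γ) Δ^m = F ∣ γ` has a `q_M`-expansion (file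
`…Quotient`); the cusp-pole removal theorem (file `…CuspBound`) shows that `G` is bounded at
every cusp, so `G` is a modular form of weight `k` on `Γ₁(M)` with `q`-expansion `g` — which is
the conclusion of β′. No Galois representations, no named facts: Mathlib only.
-/

set_option linter.dupNamespace false -- project-wide option (lakefile weak.linter.dupNamespace); `Summit.Langlands.Langlands` is the mandated namespace

noncomputable section

open Complex Filter UpperHalfPlane Function ModularForm SlashInvariantFormClass ModularFormClass
  Matrix.SpecialLinearGroup CongruenceSubgroup

open scoped Real Topology MatrixGroups ModularForm Manifold

open Function.Periodic (qParam)

namespace Summit.Langlands.Langlands.Theorems.CapacityClassicality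

/-- `1` is a strict period of `Γ₁(M)`. -/
lemma one_mem_strictPeriods_Gamma1 (M : ℕ) :
    (1 : ℝ) ∈ (Gamma1 M : Subgroup (GL (Fin 2) ℝ)).strictPeriods := by
  simp

/-- **The modular form `F / Δ ^ m`.** If `F ∈ M_{k'}(Γ₁(M))` has `qExpansion 1 F = g · Δ^m` with
`g = ∑ g n qⁿ` of radius `≥ 1` whose coefficients satisfy the `T_ℓ`-eigenvalue relation for a
prime `ℓ` with `ψℓ ≠ 0`, then `F / Δ ^ m` is a modular form of weight `k = k' - 12 m` on
`Γ₁(M)`, with `q`-expansion `g`. -/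
theorem exists_modularForm_div {M : ℕ} [NeZero M] {k' : ℤ} (F : ModularForm (Gamma1 M) k')
    (m : ℕ) (k : ℤ) (hk : k = k' - m * 12) {g : ℕ → ℂ}
    (hrad : ∀ t : ℝ, 0 < t → t < 1 → ∃ C : ℝ, ∀ n, ‖g n‖ * t ^ n ≤ C)
    (hF : qExpansion 1 F = PowerSeries.mk g * (qExpansion 1 ModularForm.discriminant) ^ m)
    {ℓ : ℕ} (hℓ : ℓ.Prime) {ψℓ : ℂ} (hψ : ψℓ ≠ 0)
    (hrel : ∀ n : ℕ, 0 < n →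
      g (ℓ * n) + (if ℓ ∣ n then ψℓ * (ℓ : ℂ) ^ (k - 1) * g (n / ℓ) else 0) = g ℓ * g n) :
    ∃ G : ModularForm (Gamma1 M) k, (∀ τ : ℍ, G τ = F τ / ModularForm.discriminant τ ^ m) ∧
      qExpansion 1 G = PowerSeries.mk g := by
  haveI : NeZero ℓ := ⟨hℓ.ne_zero⟩
  have hM : 0 < M := Nat.pos_of_ne_zero (NeZero.ne M)
  -- the `q`-series of `F / Δ ^ m`
  have hG : ∀ τ : ℍ, HasSum (fun n ↦ g n * qParam 1 τ ^ n) (F τ / ModularForm.discriminant τ ^ m) := by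
    intro τ
    have hq : ‖qParam (1 : ℝ) (τ : ℂ)‖ < 1 := Periodic.norm_qParam_lt_one one_pos τ.im_pos
    have hs := (summable_norm_mul_pow_of_bound hrad hq).of_norm.hasSum
    rw [eq_tsum_mul_discriminant_pow (one_mem_strictPeriods_Gamma1 M) F m hrad hF τ,
      mul_div_cancel_right₀ _ (pow_ne_zero _ (ModularForm.discriminant_ne_zero τ))]
    exact hs
  -- boundedness at every cusp: cusp-pole removal
  have hbdd : ∀ γ : SL(2, ℤ),
      IsBoundedAtImInfty ((fun τ ↦ F τ / ModularForm.discriminant τ ^ m) ∣[k] γ) := by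
    refine isBoundedAtImInfty_slash_of_hecke (G := fun τ ↦ F τ / ModularForm.discriminant τ ^ m)
      (M := M) (m := m) (ℓ := ℓ) hM hℓ hψ (fun γ' ↦ ?_) (hecke_relation_of_coeff hG hrel)
    obtain ⟨b, hb⟩ := exists_hasSum_slash F γ'
    exact ⟨b, fun τ ↦ by rw [slash_div_discriminant_pow_mul F m k hk γ' τ]; exact hb τ⟩
  let G : ModularForm (Gamma1 M) k :=
    { toFun := fun τ ↦ F τ / ModularForm.discriminant τ ^ m
      slash_action_eq' := fun A hA ↦ by
        obtain ⟨γ, hγ, rfl⟩ := hA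
        exact slash_div_discriminant_pow_of_mem F m k hk hγ
      holo' := mdifferentiable_div_discriminant_pow F m
      bdd_at_cusps' := fun {c} hc ↦ by
        rw [Subgroup.IsArithmetic.isCusp_iff_isCusp_SL2Z] at hc
        rw [OnePoint.isBoundedAt_iff_forall_SL2Z hc]
        intro γ _
        exact hbdd γ }
  have hGτ : ∀ τ : ℍ, G τ = F τ / ModularForm.discriminant τ ^ m := fun τ ↦ rfl
  refine ⟨G, hGτ, ?_⟩
  have hG' : ∀ τ : ℍ, HasSum (fun n ↦ g n • qParam 1 τ ^ n) (G τ) := fun τ ↦ by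
    simpa [hGτ, smul_eq_mul] using hG τ
  ext n
  rw [PowerSeries.coeff_mk]
  exact (ModularFormClass.qExpansion_coeff_unique one_pos (one_mem_strictPeriods_Gamma1 M)
    hG' n).symm

end Summit.Langlands.Langlands.Theorems.CapacityClassicality

namespace Summit.Langlands.Langlands.Theorems

open CapacityClassicality

/-- **Glue α → β′ of route CapacityClassicality** (item stmt-Langlands-10367):
`IntegralOverconvergentIsCongruence → EigenIntegralOverconvergentIsClassical`. From α, the
`q`-expansion `g = ∑ σ₀(a n) qⁿ` of β′ satisfies `qExpansion 1 F = g · Δ ^ m` for a classical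
`F ∈ M_{k+12m}(Γ₁(M))`; the quotient `F / Δ ^ m` is holomorphic on `ℍ` and at `i∞`,
`Γ₁(M)`-invariant of weight `k`, and — being `T_ℓ`-eigen for a prime `ℓ > N p` — bounded at every
cusp (cusp-pole removal), hence a modular form of weight `k` on `Γ₁(M)` with `q`-expansion `g`. -/
theorem congruenceToClassical_proof :
    Summit.Langlands.Langlands.Theses.CapacityClassicality.CongruenceToClassical := by
  unfold Summit.Langlands.Langlands.Theses.CapacityClassicality.CongruenceToClassical
    Summit.Langlands.Langlands.Theses.CapacityClassicality.EigenIntegralOverconvergentIsClassical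
  intro hα p _ hp N _ hpN k ι E _ _ σ₀ a ψ _ hint hrad hkatz hhecke
  obtain ⟨M, hM, m, F, hF⟩ := hα p hp N hpN k ι E σ₀ a hint hrad hkatz
  -- a prime `ℓ > N p`, hence `ℓ ∤ N p` and `ψ ℓ ≠ 0`
  obtain ⟨ℓ, hℓNp, hℓ⟩ := Nat.exists_infinite_primes (N * p + 1)
  have hp0 : 0 < p := lt_of_lt_of_le (by norm_num) hp
  have hN0 : 0 < N := Nat.pos_of_ne_zero (NeZero.ne N)
  have hndvd : ¬ ℓ ∣ N * p := fun h ↦ by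
    have := Nat.le_of_dvd (Nat.mul_pos hN0 hp0) h
    omega
  have hℓN : ¬ ℓ ∣ N := fun h ↦ hndvd (dvd_mul_of_dvd_left h p)
  have hψ : ψ ℓ ≠ 0 := by
    have hu : IsUnit ((ℓ : ℕ) : ZMod N) := by
      rw [ZMod.isUnit_iff_coprime]
      exact (Nat.Prime.coprime_iff_not_dvd hℓ).mpr hℓN
    exact (hu.map ψ).ne_zero
  -- the coefficient relation in the required shape
  have hrel : ∀ n : ℕ, 0 < n → σ₀ (a (ℓ * n)) +
      (if ℓ ∣ n then ψ ℓ * (ℓ : ℂ) ^ (k - 1) * σ₀ (a (n / ℓ)) else 0) = σ₀ (a ℓ) * σ₀ (a n) :=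
    fun n hn ↦ hhecke ℓ n hℓ hndvd hn
  have hradσ : ∀ t : ℝ, 0 < t → t < 1 → ∃ C : ℝ, ∀ n, ‖σ₀ (a n)‖ * t ^ n ≤ C := hrad σ₀
  have hF' : qExpansion 1 F = PowerSeries.mk (fun n ↦ σ₀ (a n)) *
      (qExpansion 1 ModularForm.discriminant) ^ m := by
    simpa using hF
  have hk : k = (k + 12 * (m : ℤ)) - m * 12 := by ring
  obtain ⟨G, -, hG⟩ := exists_modularForm_div F m k hk hradσ hF' hℓ hψ hrel
  exact ⟨M, hM, G, hG⟩

end Summit.Langlands.Langlands.Theorems
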